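import Literature.Analysis.FluidPDE.Tao2016AveragedNS.SeedScaleIgnition
import HarnessLib

/-!
# The stall pre-load of Tao's delay gate is the discounted seed, up to a factor 16

Cell `pub-fluidc`, blueprint seat 1 (gen 13). HONEST FRAMING: low prior, high value-of-information
experiment on Tao's machine paradigm [Tao2016AveragedNS, §5.5]; NOT a claim that NS blows up.

Corollaries of `ignition_forced` (SeedScaleIgnition.lean) for EXACT flow lines of a member
`delayCircuitWith K M ε` under the family's standing hypotheses, with `s := ε²e^{-M}` the total
production of the seed channel `ċ ∋ ε²e^{-M}a²` over one cycle:

* `exists_abs_c_gt_sq_of_kick_le`: from a negatively kicked datum `kickInit (-κ)` with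
  `0 ≤ κ ≤ s/(8√M)` (Tao's datum (5.6) itself is `κ = 0`), the trigger exceeds the ignition
  magnitude, `|c| > ε²`, at some time in `[0, 8/5]`;
* `negativeKick_preload_gt_of_small`: hence every pre-load `κ ≥ 0` whose flow line keeps
  `|c| ≤ ε²` on `[0, 8/5]` satisfies `κ > s/(8√M)`;
* `exists_negativeKick_dud_window`: the stalled ("dud") flow line of NegativeKickSharp.lean
  (`exists_negativeKick_dud_sharp`: `c(2) = 0`, `-3s ≤ c ≤ 0` and `|d|, |e| ≤ 6e^{-M}` on `[0,2]`)
  re-exported with the TWO-SIDED window `s/(8√M) < κ < 2s/√M` for its pre-load.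

So the negative pre-load that stalls the gate over a cycle is the discounted seed `s/√M`, pinned to
within a factor `16`; the numerics of the cell (kit job j054490) put it at `≈ 1.2533·s/√M`.
-/

namespace Literature.Analysis.FluidPDE.Tao2016AveragedNS

open Real Set

variable {K M ε : ℝ}

/-- A pre-load below the ignition budget is tiny: `s/(8√M) ≤ 1/1000000`.
[cite: Tao2016AveragedNS, Theorem 5.3] -/
theorem seedBudget_le (hK : 2 * 20 ^ 42 * (Nat.factorial 42 : ℝ) + 16 ≤ K)
    (hML : 3000 * Real.log K ≤ M) (hMK : M ≤ K ^ 10) (hε : 0 < ε)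
    (hεle : ε ≤ exp (-(10 * M)) / K ^ 100) :
    ε ^ 2 * exp (-M) / (8 * Real.sqrt M) ≤ 1 / 1000000 := by
  obtain ⟨-, hε1, hε2, hexpM, -, -, -, h77, -⟩ := Ignition.ignition_params hK hML hMK hε hεle
  have h1 : ε ^ 2 * exp (-M) ≤ 1 / 100000 * (1 / 1000000) :=
    mul_le_mul hε2 hexpM (exp_pos _).le (by norm_num)
  have h2 : ε ^ 2 * exp (-M) / (8 * Real.sqrt M) ≤ ε ^ 2 * exp (-M) :=
    div_le_self (by positivity) (by linarith)
  linarith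

/-- **Exact flow lines below the budget ignite.** From `kickInit (-κ)` with `0 ≤ κ ≤ ε²e^{-M}/(8√M)`
(in particular from Tao's datum, `κ = 0`) the trigger mode of the exact flow line exceeds `ε²` in
absolute value at some time in `[0, 8/5]`. [cite: Tao2016AveragedNS, §5.5 Theorem 5.3] -/
theorem exists_abs_c_gt_sq_of_kick_le (hK : 2 * 20 ^ 42 * (Nat.factorial 42 : ℝ) + 16 ≤ K)
    (hML : 3000 * Real.log K ≤ M) (hMK : M ≤ K ^ 10) (hε : 0 < ε)
    (hεle : ε ≤ exp (-(10 * M)) / K ^ 100) {κ : ℝ} (hκ0 : 0 ≤ κ)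
    (hκ : κ ≤ ε ^ 2 * exp (-M) / (8 * Real.sqrt M)) :
    ∃ t ∈ Icc (0 : ℝ) (8 / 5), ε ^ 2 < |delayFlowWith K M ε t (kickInit (-κ)) 2| := by
  have hκ1 : κ ≤ 1 := by linarith [seedBudget_le hK hML hMK hε hεle]
  have hκsq : (-κ) ^ 2 ≤ 1 := by nlinarith
  have hX : ∀ t, HasDerivAt (fun s => delayFlowWith K M ε s (kickInit (-κ)))
      (delayCircuitWith K M ε (delayFlowWith K M ε t (kickInit (-κ)))) t :=
    hasDerivAt_delayFlowWith K M ε (kickInit (-κ))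
  refine ignition_forced K M ε 0 κ 2 (fun s => delayFlowWith K M ε s (kickInit (-κ)))
    (fun s => delayCircuitWith K M ε (delayFlowWith K M ε s (kickInit (-κ)))) hK hML hMK hε hεle
    le_rfl hX (fun t _ => by simp) (fun t _ => ?_) ?_ (by simpa using hκ)
  · exact (kickW_norm_le_one hX (delayFlowWith_zero K M ε _) hκsq t).trans (by norm_num)
  · simpa [delayFlowWith_zero] using norm_kickInit_neg_sub_delayInit hκ0 hκ1

/-- **Stalling needs more than the budget.** A pre-load `κ ≥ 0` whose exact flow line keeps
`|c| ≤ ε²` on `[0, 8/5]` exceeds `ε²e^{-M}/(8√M)`. [cite: Tao2016AveragedNS, §5.5 Theorem 5.3] -/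
theorem negativeKick_preload_gt_of_small (hK : 2 * 20 ^ 42 * (Nat.factorial 42 : ℝ) + 16 ≤ K)
    (hML : 3000 * Real.log K ≤ M) (hMK : M ≤ K ^ 10) (hε : 0 < ε)
    (hεle : ε ≤ exp (-(10 * M)) / K ^ 100) {κ : ℝ} (hκ0 : 0 ≤ κ)
    (hsmall : ∀ t ∈ Icc (0 : ℝ) (8 / 5), |delayFlowWith K M ε t (kickInit (-κ)) 2| ≤ ε ^ 2) :
    ε ^ 2 * exp (-M) / (8 * Real.sqrt M) < κ := by
  by_contra h
  obtain ⟨t, ht, hgt⟩ := exists_abs_c_gt_sq_of_kick_le hK hML hMK hε hεle hκ0 (le_of_not_gt h)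
  exact absurd (hsmall t ht) (not_le.2 hgt)

/-- **The dud's pre-load, two-sided.** The stalled negative-kick flow line of
`exists_negativeKick_dud_sharp` (`c(2) = 0`, `-3ε²e^{-M} ≤ c ≤ 0`, `|d|, |e| ≤ 6e^{-M}` on `[0,2]`)
has its pre-load in the window `ε²e^{-M}/(8√M) < κ < 2ε²e^{-M}/√M`: the stall threshold of the
gate is the discounted seed up to a factor `16`. [cite: Tao2016AveragedNS, §5.5 Theorem 5.3] -/
theorem exists_negativeKick_dud_window (hK : 2 * 20 ^ 42 * (Nat.factorial 42 : ℝ) + 16 ≤ K)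
    (hML : 3000 * Real.log K ≤ M) (hMK : M ≤ K ^ 10) (hε : 0 < ε)
    (hεle : ε ≤ exp (-(10 * M)) / K ^ 100) :
    ∃ κ : ℝ, ε ^ 2 * exp (-M) / (8 * Real.sqrt M) < κ ∧ κ < 2 * (ε ^ 2 * exp (-M)) / Real.sqrt M ∧
      delayFlowWith K M ε 2 (kickInit (-κ)) 2 = 0 ∧
      ∀ t ∈ Icc (0 : ℝ) 2,
        delayFlowWith K M ε t (kickInit (-κ)) 2 ≤ 0 ∧
        -(3 * (ε ^ 2 * exp (-M))) ≤ delayFlowWith K M ε t (kickInit (-κ)) 2 ∧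
        |delayFlowWith K M ε t (kickInit (-κ)) 3| ≤ 6 * exp (-M) ∧
        |delayFlowWith K M ε t (kickInit (-κ)) 4| ≤ 6 * exp (-M) := by
  obtain ⟨κ, hκ0, hκup, h2, hall⟩ := exists_negativeKick_dud_sharp hK hML hMK hε hεle
  obtain ⟨-, hε1, hε2, hexpM, -, -, -, h77, -⟩ := Ignition.ignition_params hK hML hMK hε hεle
  refine ⟨κ, ?_, hκup, h2, hall⟩
  refine negativeKick_preload_gt_of_small hK hML hMK hε hεle hκ0.le fun t ht => ?_
  obtain ⟨hc0, hc3, -, -⟩ := hall t ⟨ht.1, ht.2.trans (by norm_num)⟩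
  rw [abs_le]
  have h3 : 3 * (ε ^ 2 * exp (-M)) ≤ ε ^ 2 := by nlinarith [pow_pos hε 2]
  constructor <;> nlinarith [pow_pos hε 2]

end Literature.Analysis.FluidPDE.Tao2016AveragedNS
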